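import Mathlib.Algebra.Order.BigOperators.Ring.Finset
import Mathlib.Data.Nat.Choose.Sum
import Mathlib.Data.Nat.Choose.Multinomial
import Mathlib.Analysis.SpecialFunctions.Log.NegMulLog
import Mathlib.Analysis.SpecialFunctions.Pow.Real
import Literature.Combinatorics.Enumerative.BalancedIndices
import HarnessLib

/-!
# The multinomial coefficient is `2^{n H(type)}` up to a factor `(n+1)^{N}` (method of types)

Topic `Literature/InformationTheory/Entropy`. For natural numbers `l₁, …, l_N` with sum `n`, the
multinomial coefficient satisfies
`n! / (l₁! ⋯ l_N!) ≤ ∏ᵢ (n / lᵢ)^{lᵢ} = 2^{n H(l/n)}`,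
`H` the Shannon entropy of the distribution `(l₁/n, …, l_N/n)` — the upper half of the standard
estimate `(n+1)^{-N} 2^{nH(P)} ≤ |T(P)| ≤ 2^{nH(P)}` for the size of a type class (Csiszár–Körner,
*Information Theory*, Lemma 2.3; Cover–Thomas, *Elements of Information Theory*, Thm. 11.1.3),
equivalently `n! ∏ lᵢ^{lᵢ} ≤ nⁿ ∏ lᵢ!`. PROVED here by induction on the number of parts from the
binomial theorem (`C(n,k) kᵏ (n-k)^{n-k} ≤ nⁿ` is one term of `(k + (n-k))ⁿ`):

* `choose_mul_pow_mul_pow_le` — `C(a+b, a) aᵃ bᵇ ≤ (a+b)^{a+b}`;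
* `factorial_sum_mul_prod_pow_le` — `(∑ lᵢ)! ∏ lᵢ^{lᵢ} ≤ (∑ lᵢ)^{∑ lᵢ} ∏ lᵢ!` (over any `Finset`);
* `multinomial_le_prod_div_pow` — the real form `n!/∏ lᵢ! ≤ ∏ (n/lᵢ)^{lᵢ}`;
* `log_prod_div_pow_eq` — `log ∏ (n/lᵢ)^{lᵢ} = n · ∑ᵢ (-(lᵢ/n) log (lᵢ/n))` (`= n H(l/n)` in nats,
  Mathlib's `Real.negMulLog`), so that `log (n!/∏ lᵢ!) ≤ n H_nat(l/n)`
  (`log_multinomial_le`).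

## The lower half (Csiszár–Körner Lemma 2.3 / Cover–Thomas Thm. 11.1.3, lower bound) — 2026-08-27

`(n+1)^{-N} ∏ᵢ (n/lᵢ)^{lᵢ} ≤ n!/(l₁! ⋯ l_N!)`, equivalently `nⁿ ∏ lᵢ! ≤ (n+1)^N · n! ∏ lᵢ^{lᵢ}`,
PROVED here by the printed argument (Csiszár–Körner, proof of Lemma 2.3: "the `P^k`-probability of
`T_Q` is maximized for `Q = P`" by "the obvious inequality `n!/m! ≤ n^{n-m}`", and the type counting
Lemma 2.2), phrased on count vectors: expand `nⁿ = (∑ᵢ lᵢ)ⁿ` by the multinomial theorem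
(`Finset.sum_pow_eq_sum_piAntidiag`) into at most `(n+1)^N` terms (`card_piAntidiag_le_pow`, the
type counting lemma), each at most the `l`-term `n!/∏ lᵢ! · ∏ lᵢ^{lᵢ}`
(`multinomial_mul_prod_pow_mul_prod_factorial_le`, from the obvious inequality in cleared form
`q! qᵗ ≤ t! q^q` = the tree's `Literature.Combinatorics.Enumerative.BalancedIndices.factorial_mul_pow_le`,
whose `multinomial_le_central` is the equidistributed special case of the termwise bound):

* `pow_sum_mul_prod_factorial_le` — `(∑ lᵢ)^{∑ lᵢ} ∏ lᵢ! ≤ (∑ lᵢ + 1)^{|s|} ((∑ lᵢ)! ∏ lᵢ^{lᵢ})`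
  (over any `Finset`);
* `prod_div_pow_le_pow_mul_multinomial` — the real form
  `∏ (n/lᵢ)^{lᵢ} ≤ (n+1)^{|ι|} · n!/∏ lᵢ!`;
* `le_log_multinomial` — `n H_nat(l/n) − |ι| log (n+1) ≤ log (n!/∏ lᵢ!)`, so that with
  `log_multinomial_le`: `|log (n!/∏ lᵢ!) − n H_nat(l/n)| ≤ |ι| log (n+1)`;
* `le_log_multinomial_of_eq_mul` — the same with the type given as a real vector `p`, `lᵢ = n pᵢ`.

The lower half is the entropy of a uniform mixture over the `n!/∏ lᵢ!` arrangements of `n` blocks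
with prescribed block-type counts `l` (Boltzmann counting; used for product trial states in
Gibbs-variational lower bounds on lattice pressures).

Used by the Keyl–Werner spectrum estimation bound for the quantum functionals of
Christandl–Vrana–Zuiddam (`Literature/Computability/AlgebraicComplexity/QuantumFunctionals*.lean`,
CVZ Rem. 3.7: "`[λ] ≤ n!/∏ λ_ℓ!`" and the entropy form of the right-hand side).

## References

* I. Csiszár, J. Körner, *Information Theory: Coding Theorems for Discrete Memoryless Systems*,
  2nd ed., Cambridge University Press (2011), Ch. 2, Lemma 2.2 (type counting) and Lemma 2.3 with
  its proof. [folklore] [CsiszarKorner2011]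
* T. M. Cover, J. A. Thomas, *Elements of Information Theory*, 2nd ed. (2006), Thm. 11.1.3
  (`(n+1)^{-|𝒳|} 2^{nH(P)} ≤ |T(P)| ≤ 2^{nH(P)}`). [folklore] [CoverThomas2006]
* M. Christandl, P. Vrana, J. Zuiddam, J. Amer. Math. Soc. 36 (2023), Rem. 3.7.
  [ChristandlVranaZuiddam2023]

## Mathlib

`add_pow` (binomial theorem), `Nat.choose_mul_factorial_mul_factorial`, `Finset.single_le_sum`,
`Real.negMulLog`, `Real.log_prod`, `Real.log_rpow`/`Real.log_pow`; for the lower half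
`Finset.sum_pow_eq_sum_piAntidiag` (multinomial theorem), `Nat.multinomial_spec`,
`Finset.card_pi`, `Finset.card_le_card_of_injOn`. Mathlib has no bound of this kind (grep
`multinomial` with `pow`/`entropy`: nothing).
-/

open scoped BigOperators

namespace Literature.InformationTheory.Entropy

/-! ### The binomial step -/

/-- **One term of the binomial theorem**: `C(a+b, a) aᵃ bᵇ ≤ (a+b)^{a+b}`. [folklore] -/
theorem choose_mul_pow_mul_pow_le (a b : ℕ) :
    (a + b).choose a * a ^ a * b ^ b ≤ (a + b) ^ (a + b) := by
  rw [add_pow a b (a + b)]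
  have hmem : a ∈ Finset.range (a + b + 1) := Finset.mem_range.2 (by omega)
  have hle := Finset.single_le_sum (f := fun m => a ^ m * b ^ (a + b - m) * (a + b).choose m)
    (fun m _ => Nat.zero_le _) hmem
  simp only [Nat.add_sub_cancel_left] at hle
  calc (a + b).choose a * a ^ a * b ^ b = a ^ a * b ^ b * (a + b).choose a := by ring
    _ ≤ _ := hle

/-- `(a+b)! aᵃ bᵇ ≤ (a+b)^{a+b} a! b!`. [folklore] -/
theorem factorial_add_mul_pow_mul_pow_le (a b : ℕ) :
    (a + b).factorial * a ^ a * b ^ b ≤ (a + b) ^ (a + b) * a.factorial * b.factorial := by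
  have h := choose_mul_pow_mul_pow_le a b
  have hchoose : (a + b).choose a * a.factorial * b.factorial = (a + b).factorial := by
    have := Nat.choose_mul_factorial_mul_factorial (Nat.le_add_right a b)
    rwa [Nat.add_sub_cancel_left] at this
  calc (a + b).factorial * a ^ a * b ^ b
      = ((a + b).choose a * a ^ a * b ^ b) * (a.factorial * b.factorial) := by
        rw [← hchoose]; ring
    _ ≤ (a + b) ^ (a + b) * (a.factorial * b.factorial) := Nat.mul_le_mul_right _ h
    _ = (a + b) ^ (a + b) * a.factorial * b.factorial := by ring

/-! ### The multinomial bound -/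

/-- **`(∑ lᵢ)! ∏ lᵢ^{lᵢ} ≤ (∑ lᵢ)^{∑ lᵢ} ∏ lᵢ!`** (the multinomial coefficient `(∑ lᵢ)!/∏ lᵢ!`
is at most `∏ ((∑ l)/lᵢ)^{lᵢ} = 2^{nH}`; Csiszár–Körner Lemma 2.3, upper bound), by induction on
the index set with the binomial step. [folklore] -/
theorem factorial_sum_mul_prod_pow_le {ι : Type*} (s : Finset ι) (l : ι → ℕ) :
    (∑ i ∈ s, l i).factorial * ∏ i ∈ s, l i ^ l i ≤
      (∑ i ∈ s, l i) ^ (∑ i ∈ s, l i) * ∏ i ∈ s, (l i).factorial := by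
  classical
  induction s using Finset.induction_on with
  | empty => simp
  | insert a s ha ih =>
    rw [Finset.sum_insert ha, Finset.prod_insert ha, Finset.prod_insert ha]
    set m := ∑ i ∈ s, l i with hm
    set X := ∏ i ∈ s, l i ^ l i with hX
    set Y := ∏ i ∈ s, (l i).factorial with hY
    -- `ih : m! X ≤ m^m Y`; binomial step:
    -- `(l a + m)! (l a)^{l a} m^m ≤ (l a + m)^{l a + m} (l a)! m!`
    have hstep := factorial_add_mul_pow_mul_pow_le (l a) m
    have hmpos : 0 < m.factorial := Nat.factorial_pos m
    -- multiply `ih` by `(l a + m)! (l a)^{l a}` and `hstep` by `Y`, then cancel `m!`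
    refine Nat.le_of_mul_le_mul_right ?_ hmpos
    calc (l a + m).factorial * (l a ^ l a * X) * m.factorial
        = (l a + m).factorial * l a ^ l a * (m.factorial * X) := by ring
      _ ≤ (l a + m).factorial * l a ^ l a * (m ^ m * Y) := Nat.mul_le_mul_left _ ih
      _ = ((l a + m).factorial * l a ^ l a * m ^ m) * Y := by ring
      _ ≤ ((l a + m) ^ (l a + m) * (l a).factorial * m.factorial) * Y :=
        Nat.mul_le_mul_right _ hstep
      _ = (l a + m) ^ (l a + m) * ((l a).factorial * Y) * m.factorial := by ring

/-- **The multinomial coefficient is at most `∏ᵢ (n/lᵢ)^{lᵢ}`** (`n = ∑ lᵢ`; real form of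
`factorial_sum_mul_prod_pow_le`; factors with `lᵢ = 0` are `1`). [folklore] -/
theorem multinomial_le_prod_div_pow {ι : Type*} [Fintype ι] (l : ι → ℕ) :
    ((∑ i, l i).factorial : ℝ) / ∏ i, ((l i).factorial : ℝ) ≤
      ∏ i, ((∑ i, l i : ℕ) / (l i : ℝ)) ^ l i := by
  set n := ∑ i, l i with hn
  have hfac : 0 < ∏ i, ((l i).factorial : ℝ) :=
    Finset.prod_pos fun i _ => Nat.cast_pos.2 (Nat.factorial_pos _)
  rw [div_le_iff₀ hfac]
  -- `∏ (n / l i)^{l i} * ∏ (l i)! = (n^n ∏ (l i)!) / ∏ (l i)^{l i}` with the `0^0` convention: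
  -- prove the cleared inequality `n! ∏ l^l ≤ n^n ∏ l!` and divide factorwise.
  have key : ((n.factorial : ℝ)) * ∏ i, ((l i : ℝ) ^ l i) ≤
      ((n : ℝ) ^ n) * ∏ i, ((l i).factorial : ℝ) := by
    have h := factorial_sum_mul_prod_pow_le (Finset.univ : Finset ι) l
    rw [← hn] at h
    exact_mod_cast h
  -- factorwise: `(n / l)^l * l^l = n^l`, and `∏ n^{l i} = n^n`
  have hsplit : ∀ i, ((n : ℝ) / (l i : ℝ)) ^ l i * ((l i : ℝ) ^ l i) = (n : ℝ) ^ l i := by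
    intro i
    rcases Nat.eq_zero_or_pos (l i) with h0 | hpos
    · rw [h0]; simp
    · rw [← mul_pow, div_mul_cancel₀ _ (Nat.cast_ne_zero.2 hpos.ne')]
  have hprod : (∏ i, ((n : ℝ) / (l i : ℝ)) ^ l i) * ∏ i, ((l i : ℝ) ^ l i) = (n : ℝ) ^ n := by
    rw [← Finset.prod_mul_distrib, Finset.prod_congr rfl fun i _ => hsplit i,
      Finset.prod_pow_eq_pow_sum]
  -- if some `l i = 0`… the product `∏ l^l` is still positive (`0^0 = 1`)
  have hllpos : 0 < ∏ i, ((l i : ℝ) ^ l i) := by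
    refine Finset.prod_pos fun i _ => ?_
    rcases Nat.eq_zero_or_pos (l i) with h0 | hpos
    · rw [h0]; simp
    · exact pow_pos (Nat.cast_pos.2 hpos) _
  calc (n.factorial : ℝ)
      = ((n.factorial : ℝ) * ∏ i, ((l i : ℝ) ^ l i)) / ∏ i, ((l i : ℝ) ^ l i) := by
        rw [mul_div_assoc, div_self hllpos.ne', mul_one]
    _ ≤ (((n : ℝ) ^ n) * ∏ i, ((l i).factorial : ℝ)) / ∏ i, ((l i : ℝ) ^ l i) :=
        div_le_div_of_nonneg_right key hllpos.le
    _ = (∏ i, ((n : ℝ) / (l i : ℝ)) ^ l i) * ∏ i, ((l i).factorial : ℝ) := by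
        rw [← hprod]
        field_simp

/-- **Entropy form of the right-hand side**: `log ∏ᵢ (n/lᵢ)^{lᵢ} = n ∑ᵢ η(lᵢ/n)` with
`η(x) = -x log x` (`Real.negMulLog`), i.e. `n` times the Shannon entropy (nats) of the type
`(lᵢ/n)ᵢ`. [folklore] -/
theorem log_prod_div_pow_eq {ι : Type*} [Fintype ι] (l : ι → ℕ) (hn : 0 < ∑ i, l i) :
    Real.log (∏ i, ((∑ i, l i : ℕ) / (l i : ℝ)) ^ l i) =
      (∑ i, l i : ℕ) * ∑ i, Real.negMulLog ((l i : ℝ) / (∑ i, l i : ℕ)) := by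
  set n := ∑ i, l i with hn'
  have hnpos : (0 : ℝ) < n := Nat.cast_pos.2 hn
  rw [Real.log_prod]
  · rw [Finset.mul_sum]
    refine Finset.sum_congr rfl fun i _ => ?_
    rcases Nat.eq_zero_or_pos (l i) with h0 | hpos
    · rw [h0]; simp [Real.negMulLog]
    · have hl : (0 : ℝ) < l i := Nat.cast_pos.2 hpos
      rw [Real.log_pow, Real.log_div hnpos.ne' hl.ne', Real.negMulLog,
        Real.log_div hl.ne' hnpos.ne']
      field_simp
      ring
  · intro i _
    rcases Nat.eq_zero_or_pos (l i) with h0 | hpos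
    · rw [h0]; simp
    · exact pow_ne_zero _ (div_ne_zero hnpos.ne' (Nat.cast_ne_zero.2 hpos.ne'))

/-- **`log (n!/∏ lᵢ!) ≤ n H_nat(l/n)`**: the multinomial coefficient is at most `e^{n H}`
(`2^{n H}` with `H` in bits). [folklore] -/
theorem log_multinomial_le {ι : Type*} [Fintype ι] (l : ι → ℕ) (hn : 0 < ∑ i, l i) :
    Real.log (((∑ i, l i).factorial : ℝ) / ∏ i, ((l i).factorial : ℝ)) ≤
      (∑ i, l i : ℕ) * ∑ i, Real.negMulLog ((l i : ℝ) / (∑ i, l i : ℕ)) := by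
  rw [← log_prod_div_pow_eq l hn]
  refine Real.log_le_log ?_ (multinomial_le_prod_div_pow l)
  exact div_pos (Nat.cast_pos.2 (Nat.factorial_pos _))
    (Finset.prod_pos fun i _ => Nat.cast_pos.2 (Nat.factorial_pos _))

/-! ### The lower bound (Csiszár–Körner Lemma 2.3, lower half; Cover–Thomas Thm. 11.1.3) -/

/-- **Type counting** (Csiszár–Körner Lemma 2.2): the number of `g : ι → ℕ` supported in `s` with
`∑_{i ∈ s} g i = k` — the types of sequences in `s^k`, as count vectors — is at most `(k+1)^{|s|}`
(each count takes one of the `k+1` values `0, …, k`). [cite: CsiszarKorner2011, Ch. 2, Lemma 2.2] -/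
theorem card_piAntidiag_le_pow {ι : Type*} [DecidableEq ι] (s : Finset ι) (k : ℕ) :
    (Finset.piAntidiag s k).card ≤ (k + 1) ^ s.card := by
  have hcard : (s.pi fun _ => Finset.range (k + 1)).card = (k + 1) ^ s.card := by
    rw [Finset.card_pi, Finset.prod_const, Finset.card_range]
  rw [← hcard]
  refine Finset.card_le_card_of_injOn (fun g => fun a _ => g a) ?_ ?_
  · intro g hg
    have hg' : g ∈ Finset.piAntidiag s k := by simpa using hg
    rw [Finset.mem_piAntidiag] at hg'
    show (fun a _ => g a) ∈ s.pi fun _ => Finset.range (k + 1)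
    rw [Finset.mem_pi]
    intro a ha
    rw [Finset.mem_range, Nat.lt_succ_iff, ← hg'.1]
    exact Finset.single_le_sum (fun i _ => Nat.zero_le (g i)) ha
  · intro g hg g' hg' h
    have hg1 : g ∈ Finset.piAntidiag s k := by simpa using hg
    have hg2 : g' ∈ Finset.piAntidiag s k := by simpa using hg'
    rw [Finset.mem_piAntidiag] at hg1 hg2
    funext i
    by_cases hi : i ∈ s
    · have := congrFun (congrFun h i) hi
      simpa using this
    · have h1 : g i = 0 := by
        by_contra hne
        exact hi (hg1.2 i hne)
      have h2 : g' i = 0 := by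
        by_contra hne
        exact hi (hg2.2 i hne)
      rw [h1, h2]

/-- **Each term of the multinomial expansion of `k^k = (∑ᵢ lᵢ)^k` is at most the `l`-term**: for
counts `g` with `∑_{i∈s} gᵢ = ∑_{i∈s} lᵢ`,
`multinomial(g) · ∏ lᵢ^{gᵢ} · ∏ lᵢ! ≤ (∑ lᵢ)! · ∏ lᵢ^{lᵢ}`, i.e. `multinomial(g) ∏ lᵢ^{gᵢ} ≤
multinomial(l) ∏ lᵢ^{lᵢ}` — Csiszár–Körner: "the `P^k`-probability of `T_Q` is maximized for
`Q = P`", termwise by "the obvious inequality `n!/m! ≤ n^{n-m}`" (cleared form `q! qᵗ ≤ t! q^q`,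
the tree's `BalancedIndices.factorial_mul_pow_le`).
[cite: CsiszarKorner2011, Ch. 2, proof of Lemma 2.3] -/
theorem multinomial_mul_prod_pow_mul_prod_factorial_le {ι : Type*} (s : Finset ι) (l g : ι → ℕ)
    (hg : ∑ i ∈ s, g i = ∑ i ∈ s, l i) :
    Nat.multinomial s g * (∏ i ∈ s, l i ^ g i) * ∏ i ∈ s, (l i).factorial ≤
      (∑ i ∈ s, l i).factorial * ∏ i ∈ s, l i ^ l i := by
  have hpos : 0 < ∏ i ∈ s, (g i).factorial := Finset.prod_pos fun i _ => Nat.factorial_pos _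
  refine Nat.le_of_mul_le_mul_right ?_ hpos
  have hspec : Nat.multinomial s g * ∏ i ∈ s, (g i).factorial = (∑ i ∈ s, l i).factorial := by
    rw [mul_comm, Nat.multinomial_spec, hg]
  have hprod : (∏ i ∈ s, l i ^ g i) * ∏ i ∈ s, (l i).factorial ≤
      (∏ i ∈ s, (g i).factorial) * ∏ i ∈ s, l i ^ l i := by
    rw [← Finset.prod_mul_distrib, ← Finset.prod_mul_distrib]
    refine Finset.prod_le_prod' fun i _ => ?_
    have h := Literature.Combinatorics.Enumerative.BalancedIndices.factorial_mul_pow_le (g i) (l i)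
    calc l i ^ g i * (l i).factorial = (l i).factorial * l i ^ g i := mul_comm _ _
      _ ≤ (g i).factorial * l i ^ l i := h
  calc Nat.multinomial s g * (∏ i ∈ s, l i ^ g i) * (∏ i ∈ s, (l i).factorial) *
        ∏ i ∈ s, (g i).factorial
      = (Nat.multinomial s g * ∏ i ∈ s, (g i).factorial) *
          ((∏ i ∈ s, l i ^ g i) * ∏ i ∈ s, (l i).factorial) := by ring
    _ ≤ (Nat.multinomial s g * ∏ i ∈ s, (g i).factorial) *
          ((∏ i ∈ s, (g i).factorial) * ∏ i ∈ s, l i ^ l i) := Nat.mul_le_mul_left _ hprod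
    _ = (∑ i ∈ s, l i).factorial * (∏ i ∈ s, l i ^ l i) * ∏ i ∈ s, (g i).factorial := by
          rw [hspec]; ring

/-- **`(∑ lᵢ)^{∑ lᵢ} ∏ lᵢ! ≤ (∑ lᵢ + 1)^{|s|} · (∑ lᵢ)! ∏ lᵢ^{lᵢ}`** — the multinomial coefficient
`k!/∏ lᵢ!` (`k = ∑ lᵢ`) is at least `(k+1)^{-|s|} ∏ (k/lᵢ)^{lᵢ} = (k+1)^{-|s|} e^{kH}`
(Csiszár–Körner Lemma 2.3 / Cover–Thomas Thm. 11.1.3, LOWER bound, cleared of denominators): expand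
`k^k = (∑_{i∈s} lᵢ)^k` by the multinomial theorem, bound each of the at most `(k+1)^{|s|}` terms
(`card_piAntidiag_le_pow`) by the `l`-term (`multinomial_mul_prod_pow_mul_prod_factorial_le`).
[cite: CsiszarKorner2011, Ch. 2, Lemma 2.3] [cite: CoverThomas2006, Theorem 11.1.3] -/
theorem pow_sum_mul_prod_factorial_le {ι : Type*} (s : Finset ι) (l : ι → ℕ) :
    (∑ i ∈ s, l i) ^ (∑ i ∈ s, l i) * ∏ i ∈ s, (l i).factorial ≤
      (∑ i ∈ s, l i + 1) ^ s.card * ((∑ i ∈ s, l i).factorial * ∏ i ∈ s, l i ^ l i) := by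
  classical
  have hexp : (∑ i ∈ s, l i) ^ (∑ i ∈ s, l i) =
      ∑ g ∈ Finset.piAntidiag s (∑ i ∈ s, l i), Nat.multinomial s g * ∏ i ∈ s, l i ^ g i := by
    have h := Finset.sum_pow_eq_sum_piAntidiag s l (∑ i ∈ s, l i)
    simpa using h
  rw [hexp, Finset.sum_mul]
  calc ∑ g ∈ Finset.piAntidiag s (∑ i ∈ s, l i),
          Nat.multinomial s g * (∏ i ∈ s, l i ^ g i) * ∏ i ∈ s, (l i).factorial
      ≤ ∑ _g ∈ Finset.piAntidiag s (∑ i ∈ s, l i),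
          ((∑ i ∈ s, l i).factorial * ∏ i ∈ s, l i ^ l i) := by
        refine Finset.sum_le_sum fun g hg => ?_
        rw [Finset.mem_piAntidiag] at hg
        exact multinomial_mul_prod_pow_mul_prod_factorial_le s l g hg.1
    _ = (Finset.piAntidiag s (∑ i ∈ s, l i)).card *
          ((∑ i ∈ s, l i).factorial * ∏ i ∈ s, l i ^ l i) := by
        rw [Finset.sum_const, smul_eq_mul]
    _ ≤ (∑ i ∈ s, l i + 1) ^ s.card * ((∑ i ∈ s, l i).factorial * ∏ i ∈ s, l i ^ l i) :=
        Nat.mul_le_mul_right _ (card_piAntidiag_le_pow s _)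

/-- **The multinomial coefficient is at least `(k+1)^{-|ι|} ∏ᵢ (k/lᵢ)^{lᵢ}`** (`k = ∑ lᵢ`; real
form of `pow_sum_mul_prod_factorial_le`, factors with `lᵢ = 0` are `1`): the lower half
`(k+1)^{-|X|} exp[kH(P)] ≤ |T_P|` of Csiszár–Körner Lemma 2.3 (Cover–Thomas Thm. 11.1.3:
`(n+1)^{-|𝒳|} 2^{nH(P)} ≤ |T(P)|`), companion of `multinomial_le_prod_div_pow`.
[cite: CsiszarKorner2011, Ch. 2, Lemma 2.3] [cite: CoverThomas2006, Theorem 11.1.3] -/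
theorem prod_div_pow_le_pow_mul_multinomial {ι : Type*} [Fintype ι] (l : ι → ℕ) :
    ∏ i, ((∑ i, l i : ℕ) / (l i : ℝ)) ^ l i ≤
      ((∑ i, l i : ℕ) + 1 : ℝ) ^ Fintype.card ι *
        (((∑ i, l i).factorial : ℝ) / ∏ i, ((l i).factorial : ℝ)) := by
  set n := ∑ i, l i with hn
  have hfac : 0 < ∏ i, ((l i).factorial : ℝ) :=
    Finset.prod_pos fun i _ => Nat.cast_pos.2 (Nat.factorial_pos _)
  -- the cleared inequality, cast from `ℕ`
  have key : ((n : ℝ) ^ n) * ∏ i, ((l i).factorial : ℝ) ≤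
      ((n : ℝ) + 1) ^ Fintype.card ι * ((n.factorial : ℝ) * ∏ i, ((l i : ℝ) ^ l i)) := by
    have h := pow_sum_mul_prod_factorial_le (Finset.univ : Finset ι) l
    rw [← hn, Finset.card_univ] at h
    exact_mod_cast h
  -- factorwise: `(n / l)^l * l^l = n^l`, and `∏ n^{l i} = n^n`
  have hsplit : ∀ i, ((n : ℝ) / (l i : ℝ)) ^ l i * ((l i : ℝ) ^ l i) = (n : ℝ) ^ l i := by
    intro i
    rcases Nat.eq_zero_or_pos (l i) with h0 | hpos
    · rw [h0]; simp
    · rw [← mul_pow, div_mul_cancel₀ _ (Nat.cast_ne_zero.2 hpos.ne')]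
  have hprod : (∏ i, ((n : ℝ) / (l i : ℝ)) ^ l i) * ∏ i, ((l i : ℝ) ^ l i) = (n : ℝ) ^ n := by
    rw [← Finset.prod_mul_distrib, Finset.prod_congr rfl fun i _ => hsplit i,
      Finset.prod_pow_eq_pow_sum]
  have hllpos : 0 < ∏ i, ((l i : ℝ) ^ l i) := by
    refine Finset.prod_pos fun i _ => ?_
    rcases Nat.eq_zero_or_pos (l i) with h0 | hpos
    · rw [h0]; simp
    · exact pow_pos (Nat.cast_pos.2 hpos) _
  rw [← mul_div_assoc, le_div_iff₀ hfac]
  refine le_of_mul_le_mul_right ?_ hllpos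
  calc (∏ i, ((n : ℝ) / (l i : ℝ)) ^ l i) * (∏ i, ((l i).factorial : ℝ)) * ∏ i, ((l i : ℝ) ^ l i)
      = ((∏ i, ((n : ℝ) / (l i : ℝ)) ^ l i) * ∏ i, ((l i : ℝ) ^ l i)) *
          ∏ i, ((l i).factorial : ℝ) := by ring
    _ = (n : ℝ) ^ n * ∏ i, ((l i).factorial : ℝ) := by rw [hprod]
    _ ≤ ((n : ℝ) + 1) ^ Fintype.card ι * ((n.factorial : ℝ) * ∏ i, ((l i : ℝ) ^ l i)) := key
    _ = ((n : ℝ) + 1) ^ Fintype.card ι * (n.factorial : ℝ) * ∏ i, ((l i : ℝ) ^ l i) := by ring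

/-- **`k H_nat(l/k) − |ι| log (k+1) ≤ log (k!/∏ lᵢ!)`**: the multinomial coefficient is at least
`(k+1)^{-|ι|} e^{kH}` (`H` = the Shannon entropy, in nats, of the type `(lᵢ/k)ᵢ`, written with
Mathlib's `Real.negMulLog`) — the logarithmic form of Csiszár–Körner Lemma 2.3 / Cover–Thomas
Thm. 11.1.3 (lower bound), companion of `log_multinomial_le`. Together:
`|log (k!/∏ lᵢ!) − k H| ≤ |ι| log (k+1)`, the entropy asymptotics of the multinomial coefficient
(Boltzmann). [cite: CsiszarKorner2011, Ch. 2, Lemma 2.3] [cite: CoverThomas2006, Theorem 11.1.3] -/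
theorem le_log_multinomial {ι : Type*} [Fintype ι] (l : ι → ℕ) (hn : 0 < ∑ i, l i) :
    (∑ i, l i : ℕ) * ∑ i, Real.negMulLog ((l i : ℝ) / (∑ i, l i : ℕ)) -
        Fintype.card ι * Real.log ((∑ i, l i : ℕ) + 1) ≤
      Real.log (((∑ i, l i).factorial : ℝ) / ∏ i, ((l i).factorial : ℝ)) := by
  rw [← log_prod_div_pow_eq l hn]
  have hnpos : (0 : ℝ) < (∑ i, l i : ℕ) := Nat.cast_pos.2 hn
  have hA : 0 < ∏ i, ((∑ i, l i : ℕ) / (l i : ℝ)) ^ l i := by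
    refine Finset.prod_pos fun i _ => ?_
    rcases Nat.eq_zero_or_pos (l i) with h0 | hpos
    · rw [h0]; simp
    · exact pow_pos (div_pos hnpos (Nat.cast_pos.2 hpos)) _
  have hC : 0 < ((∑ i, l i : ℕ) + 1 : ℝ) ^ Fintype.card ι := by positivity
  have hM : 0 < ((∑ i, l i).factorial : ℝ) / ∏ i, ((l i).factorial : ℝ) :=
    div_pos (Nat.cast_pos.2 (Nat.factorial_pos _))
      (Finset.prod_pos fun i _ => Nat.cast_pos.2 (Nat.factorial_pos _))
  have h := Real.log_le_log hA (prod_div_pow_le_pow_mul_multinomial l)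
  rw [Real.log_mul hC.ne' hM.ne', Real.log_pow] at h
  linarith

/-- **Types realised exactly**: if the counts are `lᵢ = k · pᵢ` for a real vector `p` (so
`pᵢ = lᵢ/k` is the type itself), the bound reads `k ∑ᵢ η(pᵢ) − |ι| log (k+1) ≤ log (k!/∏ lᵢ!)`
(`η = Real.negMulLog`). This is the form used for the entropy `log (k!/∏ lᵢ!)` of a uniform
mixture over the `k!/∏ lᵢ!` arrangements of `k` blocks with prescribed block-type frequencies `p`.
[cite: CsiszarKorner2011, Ch. 2, Lemma 2.3] -/
theorem le_log_multinomial_of_eq_mul {ι : Type*} [Fintype ι] (l : ι → ℕ) (p : ι → ℝ)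
    (hn : 0 < ∑ i, l i) (hp : ∀ i, (l i : ℝ) = (∑ i, l i : ℕ) * p i) :
    (∑ i, l i : ℕ) * ∑ i, Real.negMulLog (p i) - Fintype.card ι * Real.log ((∑ i, l i : ℕ) + 1) ≤
      Real.log (((∑ i, l i).factorial : ℝ) / ∏ i, ((l i).factorial : ℝ)) := by
  have hnpos : (0 : ℝ) < (∑ i, l i : ℕ) := Nat.cast_pos.2 hn
  have hpi : ∀ i, p i = (l i : ℝ) / (∑ i, l i : ℕ) := by
    intro i
    rw [hp i, mul_div_cancel_left₀ _ hnpos.ne']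
  simp_rw [hpi]
  exact le_log_multinomial l hn

end Literature.InformationTheory.Entropy
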